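import Mathlib.Tactic
import HarnessLib

/-!
# Kozma–Nitzan's Question 8 — UNI-C(U;y): structural lemmas for the general (weakly connected) case (gen 39)

Support file (`--supports stmt-CriticalPhenomena-4575`, closed crux; independent mathematics on Kozma–Nitzan's Question 8,
arXiv:2401.12397 §5.5 p. 36), prover `prim-ineq-gen-6` (gen 39).  No definitions, no named facts, no sorries; standard axioms.
Memo `run/shared/lean/prim/prim-ineq-gen-6/PROOF-UNIC-Y-G39.md`.

THEOREM C-STAR (gen 38, …KnQuestion8UniCLP.lean) reduced the C-side corner condition `UNI-C(U;y)(t)` to a two-variable LP whose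
joint term carries the factor `1/(C_[k₁,t]·Φ(T_{k₁}))`.  This generation supplies the structural facts that control that factor
and recasts the reduction in the own-supply normalisation (memo THEOREM C-Y):
* `kCS_corrL_step` — the Abel step behind the **Y-form** `corrL_t = a_t·Σ_{v≤t} γ_{v−1}c_v·Hs_{v−1}` (so `W_t = c·Y_t + a_t·G_t`
  with `Y_t = a_t + γ_t − 2a_tγ_t` the own-supply coefficient and `G_t` the C-defect-weighted sum of plain cumulative emissions);
* `kCS_Ybounds` — the three lower bounds of the own supply used by the per-vertex routes;
* `kCS_phiK` — `Φ(T_{k₁}) > (1 + λ·m_{k₁})/(1+λ) ≥ 1/(1+λ)` from VIS+ and `u_{k₁} + m_{k₁} ≤ Φ(T_{k₁})`;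
* `kCS_lemmaC1` — LEMMA C1: the C-survival up to the first A-defective vertex, `C_[k₁,u*] > Φ_K/(Φ_K+λ)` (hypothesis-free:
  joint-defect budget of the vertices before `u*` against the tail bound `u_{k₁} ≤ σ_{u*}C_[k₁,u*]ǔ_{u*}`);
* `kCS_closs` — the C-LOSS lemma in the joint branch: `Σ_{w: m_w ≥ μ} c_wC_[k₁,w−1] ≤ (1−Φ_K)/(Φ_K·α·μ)`;
* `kCS_kap2` — the sharpened kill coefficient `κ_l ≥ (1−a_l)(K₃ − B(1−S_l)/4) + a_lK₄ − a_l²ΦS_{l+1}u_{l+1}` (PROPOSITION H).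
Exact link checks: lab-g39/g39/e41_lemC1.py, e45_qvis.py, e46_closs.py, e44_cand2.py (0 failures).
[cite: KozmaNitzan2024, Question 8 (§5.5 p. 36)]
-/

namespace Summit.CriticalPhenomena.PercolationContinuityZ3.Theorems

namespace PocketCert

open Finset

/-- **Abel step of the Y-form.**  With `Hs_t = Σ_{k≤t} η_k` the plain cumulative emission,
`Σ_{k<t+1}(γ_k − γ_{t+1})η_k = Σ_{k<t}(γ_k − γ_t)η_k + (γ_t − γ_{t+1})·Hs_t`; iterated, `corrL_t/a_t = Σ_{v≤t}(γ_{v−1}−γ_v)·Hs_{v−1}`,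
i.e. the C-side correction is the C-defect-weighted sum of the plain cumulative emissions.
[cite: KozmaNitzan2024, Question 8 (§5.5 p. 36)] -/
theorem kCS_corrL_step (γ η : ℕ → ℝ) (t : ℕ) :
    ∑ k ∈ range (t + 1), (γ k - γ (t + 1)) * η k
      = ∑ k ∈ range t, (γ k - γ t) * η k + (γ t - γ (t + 1)) * ∑ k ∈ range (t + 1), η k := by
  have h : ∑ k ∈ range t, (γ k - γ (t + 1)) * η k
      = ∑ k ∈ range t, (γ k - γ t) * η k + ∑ k ∈ range t, (γ t - γ (t + 1)) * η k := by
    rw [← Finset.sum_add_distrib]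
    apply Finset.sum_congr rfl
    intro k _
    ring
  rw [Finset.sum_range_succ, Finset.sum_range_succ, h, mul_add, Finset.mul_sum]
  ring

/-- **Own-supply bounds.**  `Y = a(1−γ) + γ(1−a)` (so `y_t/p_t = c·Y_t`) satisfies `Y ≥ a(1−γ)`, `Y ≥ γ(1−a)` and, when the
A-defect before the vertex is `α ≤ 1 − a`, `Y ≥ γ·α`.
[cite: KozmaNitzan2024, Question 8 (§5.5 p. 36)] -/
theorem kCS_Ybounds (a γ α : ℝ) (ha0 : 0 ≤ a) (ha1 : a ≤ 1) (hγ0 : 0 ≤ γ) (hγ1 : γ ≤ 1) (hα : α ≤ 1 - a) :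
    a * (1 - γ) ≤ a * (1 - γ) + γ * (1 - a) ∧ γ * (1 - a) ≤ a * (1 - γ) + γ * (1 - a)
      ∧ γ * α ≤ a * (1 - γ) + γ * (1 - a) := by
  refine ⟨?_, ?_, ?_⟩
  · nlinarith [mul_nonneg hγ0 (sub_nonneg.mpr ha1)]
  · nlinarith [mul_nonneg ha0 (sub_nonneg.mpr hγ1)]
  · nlinarith [mul_le_mul_of_nonneg_left hα hγ0, mul_nonneg ha0 (sub_nonneg.mpr hγ1)]

/-- **Φ(T_{k₁}) is bounded below.**  VIS+ at the last positive depth gives `(Φ+m)(1 − Φ_K) < a·Φ·S·u_{k₁}`; the A-defect channel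
and the doubly-good mass of `T_{k₁}` satisfy `u_{k₁} + m_{k₁} ≤ Φ_K`.  With `λ = aΦS/(Φ+m)`:  `Φ_K(1+λ) > 1 + λ·m_{k₁}`, in particular
`Φ_K > 1/(1+λ) ≥ 1/2`.
[cite: KozmaNitzan2024, Question 8 (§5.5 p. 36)] -/
theorem kCS_phiK (Φ m a S u mK ΦK lam : ℝ) (hΦm : 0 < Φ + m) (hlam : lam = a * Φ * S / (Φ + m))
    (hvis : (Φ + m) * (1 - ΦK) < a * Φ * S * u) (hu : u ≤ ΦK - mK) (hlam0 : 0 ≤ a * Φ * S) :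
    1 + lam * mK < ΦK * (1 + lam) := by
  have h1 : 1 - ΦK < lam * u := by
    rw [hlam, div_mul_eq_mul_div, lt_div_iff₀ hΦm]
    linarith
  have h2 : lam * u ≤ lam * (ΦK - mK) := by
    apply mul_le_mul_of_nonneg_left hu
    rw [hlam]; positivity
  linarith

/-- **LEMMA C1 (C-survival up to the first A-defective vertex), scalar core.**  Let `Cu = C_[k₁,u*]`, `σ = σ_{u*}`, `uc = ǔ_{u*}`.
From (i) `σ(1 − Cu) ≤ L` (the C-defects before `u*`, weighted by `C_[k₁,w−1]S_[w+1,u*] ≥ σ`), (ii) the joint budget of those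
vertices `L·uc·Φ_K ≤ 1 − Φ_K`, (iii) VIS+ `1 − Φ_K < λ·u_{k₁}` and (iv) the tail bound `u_{k₁} ≤ σ·Cu·uc`:
`Φ_K·(1 − Cu) < λ·Cu`, i.e. `Cu > Φ_K/(Φ_K + λ)`.
[cite: KozmaNitzan2024, Question 8 (§5.5 p. 36)] -/
theorem kCS_lemmaC1 (Cu σ uc L ΦK lam u : ℝ) (hσ : 0 < σ) (huc : 0 < uc) (hΦK : 0 ≤ ΦK)
    (h1 : σ * (1 - Cu) ≤ L) (h2 : L * uc * ΦK ≤ 1 - ΦK) (h3 : 1 - ΦK < lam * u) (h4 : u ≤ σ * Cu * uc)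
    (hlam : 0 ≤ lam) :
    ΦK * (1 - Cu) < lam * Cu := by
  have h5 : σ * (1 - Cu) * (uc * ΦK) ≤ L * (uc * ΦK) :=
    mul_le_mul_of_nonneg_right h1 (mul_nonneg huc.le hΦK)
  have h6 : lam * u ≤ lam * (σ * Cu * uc) := mul_le_mul_of_nonneg_left h4 hlam
  have h7 : σ * uc * (ΦK * (1 - Cu)) < σ * uc * (lam * Cu) := by nlinarith
  have h8 : 0 < σ * uc := mul_pos hσ huc
  exact lt_of_mul_lt_mul_left (by linarith [h7]) h8.le

/-- **C-LOSS lemma (joint branch), finite-sum core.**  If every vertex `w ∈ W` has joint weight `Ω_w ≥ Φ·α·μ·C_w` (from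
`Ω_w ≥ C_[k₁,w−1]Φ_Kα_{w−1}m_w` with `α_{w−1} ≥ α`, `m_w ≥ μ`), the defects are `c_w ≥ 0` and the joint budget is
`Σ_w c_wΩ_w ≤ J`, then `Φαμ·Σ_w c_wC_w ≤ J` — the C-survival lost after an A-defect of size `α` at joint-visible vertices is at most
`J/(Φ_Kαμ) < λu_{k₁}/(Φ_Kαμ)`.
[cite: KozmaNitzan2024, Question 8 (§5.5 p. 36)] -/
theorem kCS_closs (W : Finset ℕ) (cd Ω Cw : ℕ → ℝ) (Φ α μ J : ℝ)
    (hc : ∀ w ∈ W, 0 ≤ cd w) (hΩ : ∀ w ∈ W, Φ * α * μ * Cw w ≤ Ω w) (hJ : ∑ w ∈ W, cd w * Ω w ≤ J) :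
    Φ * α * μ * ∑ w ∈ W, cd w * Cw w ≤ J := by
  have h1 : ∑ w ∈ W, cd w * (Φ * α * μ * Cw w) ≤ ∑ w ∈ W, cd w * Ω w := by
    apply Finset.sum_le_sum
    intro w hw
    exact mul_le_mul_of_nonneg_left (hΩ w hw) (hc w hw)
  have h2 : ∑ w ∈ W, cd w * (Φ * α * μ * Cw w) = Φ * α * μ * ∑ w ∈ W, cd w * Cw w := by
    rw [Finset.mul_sum]
    apply Finset.sum_congr rfl
    intro w _
    ring
  linarith [h1, h2 ▸ h1]

/-- **Sharpened kill coefficient.**  PROPOSITION H gives `H_{l−1} ≤ B(1−S_l)/4`; hence the kill coefficient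
`κ_l = (1−a_l)(K₃ − H_{l−1}) + a_lK₄ − a_l²ΦS_{l+1}u_{l+1}` is at least `(1−a_l)(K₃ − B(1−S_l)/4) + a_lK₄ − a_l²ΦS_{l+1}u_{l+1}`
(the gen-38 aggregate chain used the weaker main constant `Φπ − c − B/4 ≤ K₃ − B/4`).
[cite: KozmaNitzan2024, Question 8 (§5.5 p. 36)] -/
theorem kCS_kap2 (a K3 K4 H B Sl X : ℝ) (ha1 : a ≤ 1) (hH : H ≤ B * (1 - Sl) / 4) :
    (1 - a) * (K3 - B * (1 - Sl) / 4) + a * K4 - X ≤ (1 - a) * (K3 - H) + a * K4 - X := by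
  nlinarith [mul_le_mul_of_nonneg_left hH (sub_nonneg.mpr ha1)]

/-- **Unified late-base bound (PROPOSITION D3′), finite-sum core.**  Over the possible starts `b` of the cluster of `w` (weights `π_b ≥ 0`,
`Σ_b π_b = 1`) the renewal weights satisfy `ρ_b ≥ Φ·π_b`; hence for A-survivals `A_b ≥ 0`:
`T2 = Σ_b ρ_bA_b ≥ Φ·Σ_b π_bA_b = Φ·(1 − Σ_b π_b(1−A_b))`, and along the path `Σ_b π_b(1−A_[b,w−1]) = α_{w−1}S̄^A_w` (Abel), so
`T2_w ≥ Φ_K(1 − α_{w−1}S̄^A_w)` and `Ω_w ≥ C_[k₁,w−1]Φ_K·M_w`, `M_w = αS̄ + (1−αS̄)ǔ_w` (memo §3 (S7); exact check lab-g39/g39/e47_T2.py).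
[cite: KozmaNitzan2024, Question 8 (§5.5 p. 36)] -/
theorem kCS_latebase (B : Finset ℕ) (π ρ A : ℕ → ℝ) (Φ : ℝ) (hπ1 : ∑ b ∈ B, π b = 1)
    (hρ : ∀ b ∈ B, Φ * π b ≤ ρ b) (hA0 : ∀ b ∈ B, 0 ≤ A b) :
    Φ * (1 - ∑ b ∈ B, π b * (1 - A b)) ≤ ∑ b ∈ B, ρ b * A b := by
  have h1 : ∑ b ∈ B, π b * (1 - A b) = ∑ b ∈ B, π b - ∑ b ∈ B, π b * A b := by
    rw [← Finset.sum_sub_distrib]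
    apply Finset.sum_congr rfl
    intro b _
    ring
  have h2 : ∑ b ∈ B, Φ * π b * A b ≤ ∑ b ∈ B, ρ b * A b := by
    apply Finset.sum_le_sum
    intro b hb
    exact mul_le_mul_of_nonneg_right (hρ b hb) (hA0 b hb)
  have h3 : ∑ b ∈ B, Φ * π b * A b = Φ * ∑ b ∈ B, π b * A b := by
    rw [Finset.mul_sum]
    apply Finset.sum_congr rfl
    intro b _
    ring
  rw [h1, hπ1]
  linarith [h2, h3]

/-- **The unified joint visibility dominates both gen-38 routes.**  With `α, ǔ ∈ [0,1]`, `S̄ ≥ 0`, `M = αS̄ + (1−αS̄)ǔ` satisfies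
`M ≥ α(S̄ + (1−S̄)ǔ) = α·m_w` (PROPOSITION D3) and `M ≥ (1−α)ǔ` (the late-base term of THEOREM W / JB4); so the single bound
`JB5 = POST₂γ_i(u_{k₁}/Φ_K)fa/(M·DEN)` replaces JB2 and JB4 of the per-vertex family (memo §2).
[cite: KozmaNitzan2024, Question 8 (§5.5 p. 36)] -/
theorem kCS_Mdom (α Sb u : ℝ) (hα0 : 0 ≤ α) (hα1 : α ≤ 1) (hS0 : 0 ≤ Sb) (hu0 : 0 ≤ u) (hu1 : u ≤ 1) :
    α * (Sb + (1 - Sb) * u) ≤ α * Sb + (1 - α * Sb) * u ∧ (1 - α) * u ≤ α * Sb + (1 - α * Sb) * u := by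
  constructor
  · nlinarith [mul_nonneg (sub_nonneg.mpr hα1) hu0, mul_nonneg (mul_nonneg (sub_nonneg.mpr hα1) hu0) hS0,
      mul_nonneg hα0 hS0]
  · nlinarith [mul_nonneg hα0 hS0, mul_nonneg (mul_nonneg hα0 hS0) (sub_nonneg.mpr hu1)]

/-- **Leaf A, step 1 (the supply absorbs the A-layer when `fa ≤ 1`).**  With `DEN_t = (1−γ_t) + γ_tφ_t`, `φ_t = 1/a_t − 1 ≥ fa_{v−1}`
and `fa_{v−1} ≤ 1`:  `fa ≤ DEN_t`, i.e. `Λ := fa/DEN_t ≤ 1` (memo THEOREM L-AB).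
[cite: KozmaNitzan2024, Question 8 (§5.5 p. 36)] -/
theorem kCS_leafA_lambda (fa φ γ : ℝ) (hfa1 : fa ≤ 1) (hφ : fa ≤ φ) (hγ0 : 0 ≤ γ) (hγ1 : γ ≤ 1) :
    fa ≤ (1 - γ) + γ * φ := by
  nlinarith [mul_le_mul_of_nonneg_left hφ hγ0, mul_le_mul_of_nonneg_left hfa1 (sub_nonneg.mpr hγ1)]

/-- **Leaf A (region-connected vertices).**  `JB3 = P·Λ/σ` with `P = POST₂γ_i ≤ 7/40` (cert_F1), `Λ ≤ 1` (previous lemma) and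
`σ_v ≥ 7/20` gives `JB3 ≤ ½`: every need-carrying vertex with `fa_{v−1} ≤ 1` and `σ_v ≥ 0.35` is certified by the joint route through
the base `k₁` (THEOREM V per vertex).
[cite: KozmaNitzan2024, Question 8 (§5.5 p. 36)] -/
theorem kCS_leafA (P Λ σ : ℝ) (hP : P ≤ 7 / 40) (hΛ0 : 0 ≤ Λ) (hΛ : Λ ≤ 1) (hσ : 7 / 20 ≤ σ) :
    P * Λ / σ ≤ 1 / 2 := by
  have hσ0 : 0 < σ := by linarith
  rw [div_le_iff₀ hσ0]
  nlinarith [mul_le_mul hP hΛ hΛ0 (by norm_num : (0:ℝ) ≤ 7 / 40)]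

/-- **Leaf B, ratio lemma (a): attached to its A-defects.**  If `S̄ ∈ [3/5, 1]`, `σ ≤ 7/20`, `α ∈ [0,1]` and `ǔ ≥ 0`, then
`(α + σ(1−α)ǔ) ≤ (5/3)·(αS̄ + (1−αS̄)ǔ)`  (the (U′)-bound of `u_{k₁}` against the unified joint weight `M_v`).
[cite: KozmaNitzan2024, Question 8 (§5.5 p. 36)] -/
theorem kCS_leafB_ratio_a (α Sb u σ : ℝ) (hα0 : 0 ≤ α) (hα1 : α ≤ 1) (hS0 : 3 / 5 ≤ Sb) (hS1 : Sb ≤ 1)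
    (hu0 : 0 ≤ u) (hσ1 : σ ≤ 7 / 20) :
    3 * (α + σ * (1 - α) * u) ≤ 5 * (α * Sb + (1 - α * Sb) * u) := by
  have h1 : 3 * α ≤ 5 * (α * Sb) := by nlinarith
  have h2 : σ * (1 - α) * u ≤ (1 - α) * u := by
    have : 0 ≤ (1 - α) * u := mul_nonneg (sub_nonneg.mpr hα1) hu0
    nlinarith
  have h3 : (1 - α) * u ≤ (1 - α * Sb) * u := by
    apply mul_le_mul_of_nonneg_right _ hu0
    nlinarith [mul_le_mul_of_nonneg_left hS1 hα0]
  nlinarith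

/-- **Leaf B, ratio lemma (b): A-defect mass after the vertex.**  If `ǔ ≥ (29/50)α`, `0 ≤ σ ≤ 7/20`, `α, S̄ ≥ 0`, `0 ≤ ǔ ≤ 1`, then with
`M = αS̄ + (1−αS̄)ǔ` (so `M ≥ ǔ`):  `α + σ(1−α)ǔ ≤ (50/29 + 7/20)·M`.
[cite: KozmaNitzan2024, Question 8 (§5.5 p. 36)] -/
theorem kCS_leafB_ratio_b (α Sb u σ : ℝ) (hα0 : 0 ≤ α) (hS0 : 0 ≤ Sb)
    (hu0 : 0 ≤ u) (hu1 : u ≤ 1) (hσ0 : 0 ≤ σ) (hσ1 : σ ≤ 7 / 20) (hu : 29 / 50 * α ≤ u) :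
    α + σ * (1 - α) * u ≤ (50 / 29 + 7 / 20) * (α * Sb + (1 - α * Sb) * u) := by
  have hM : u ≤ α * Sb + (1 - α * Sb) * u := by
    nlinarith [mul_nonneg (mul_nonneg hα0 hS0) (sub_nonneg.mpr hu1)]
  have h1 : α ≤ 50 / 29 * u := by linarith
  have h2 : σ * (1 - α) * u ≤ 7 / 20 * u := by
    nlinarith [mul_nonneg (mul_nonneg hσ0 hα0) hu0, mul_le_mul_of_nonneg_right hσ1 hu0]
  nlinarith

/-- **Leaf B (joint-visible vertices).**  `JB5u = P′·r·Λ` with `P′ = POST₂γ_i/Φ_K ≤ POST₂γ_i(1+λ) ≤ 43/200` (cert_F1 and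
`Φ_K > 1/(1+λ)`), the ratio `r ≤ 50/29 + 7/20` of the two lemmas above (the case `ǔ ≥ 1` gives `r ≤ 1` directly) and `Λ ≤ 1`
(`fa ≤ 1`):  `JB5u ≤ ½`.  Hence every need-carrying vertex with `fa_{v−1} ≤ 1`, `σ_v < 0.35` and (`S̄^A_v ≥ 3/5` or
`ǔ_v ≥ (29/50)α_{v−1}`) is certified by the unified joint route (memo THEOREM L-AB).
[cite: KozmaNitzan2024, Question 8 (§5.5 p. 36)] -/
theorem kCS_leafB (P' r Λ : ℝ) (hP0 : 0 ≤ P') (hP : P' ≤ 43 / 200) (hr0 : 0 ≤ r) (hr : r ≤ 50 / 29 + 7 / 20)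
    (hΛ : Λ ≤ 1) :
    P' * r * Λ ≤ 1 / 2 := by
  have h1 : P' * r ≤ 43 / 200 * (50 / 29 + 7 / 20) := mul_le_mul hP hr hr0 (by norm_num)
  have h2 : P' * r * Λ ≤ P' * r * 1 := mul_le_mul_of_nonneg_left hΛ (mul_nonneg hP0 hr0)
  nlinarith

/-- **LEMMA C1′ (C-defects are charged by the A-loss after them), finite-sum core.**  For the C-defective vertices `w < v`
(defects `c_w ≥ 0`) the renewal identity gives `Σ_w c_wΩ_w ≤ J = 1 − Φ_K`, and PROPOSITION D3′ with the tail bound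
`ǔ_w ≥ S_[w+1,v−1](1 − A_[w,v−1])` gives `Ω_w ≥ Φ·g_w·C_w` with the w-dependent weight `g_w = (α_{v−1} − α_{w−1})S_[w+1,v−1] ≥ 0`
and `C_w = C_[k₁,w−1]`.  Hence `Φ·Σ_w c_w g_w C_w ≤ J`: the C-defects before `v` lose at most `(1−Φ_K)/Φ_K < λu_{k₁}/Φ_K` when weighted
by the A-loss between them and `v−1` (memo §3 (S9); exact and sharp: lab-g39/g39/e52_lemC1prime.py).  LEMMA C1 is the case `α_{w−1} = 0`.
[cite: KozmaNitzan2024, Question 8 (§5.5 p. 36)] -/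
theorem kCS_lemmaC1prime (W : Finset ℕ) (cd Ω Cw g : ℕ → ℝ) (Φ J : ℝ)
    (hc : ∀ w ∈ W, 0 ≤ cd w) (hΩ : ∀ w ∈ W, Φ * g w * Cw w ≤ Ω w) (hJ : ∑ w ∈ W, cd w * Ω w ≤ J) :
    Φ * ∑ w ∈ W, cd w * g w * Cw w ≤ J := by
  have h1 : ∑ w ∈ W, cd w * (Φ * g w * Cw w) ≤ ∑ w ∈ W, cd w * Ω w := by
    apply Finset.sum_le_sum
    intro w hw
    exact mul_le_mul_of_nonneg_left (hΩ w hw) (hc w hw)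
  have h2 : ∑ w ∈ W, cd w * (Φ * g w * Cw w) = Φ * ∑ w ∈ W, cd w * g w * Cw w := by
    rw [Finset.mul_sum]
    apply Finset.sum_congr rfl
    intro w _
    ring
  linarith [h1, h2 ▸ h1]

/-- **The tail bound behind LEMMA C1′, one step.**  If `u' ≥ S'·(1 − A')` (A-defect mass of the tail) then for a vertex with mark
`A ∈ [0,1]`, edge weight `s ∈ [0,1]` and `S' ∈ [0,1]`:  `(1 − A) + A·s·u' ≥ s·S'·(1 − A·A')` (the slack is `(1−A)(1−sS')`), i.e. `ǔ_w ≥ S_[w+1,v−1](1 − A_[w,v−1])` by induction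
along the path (`ǔ_w = (1−A_w) + A_w s_{w+1} ǔ_{w+1}`).
[cite: KozmaNitzan2024, Question 8 (§5.5 p. 36)] -/
theorem kCS_ucktail_step (A s u' S' A' : ℝ) (hA0 : 0 ≤ A) (hA1 : A ≤ 1) (hs0 : 0 ≤ s) (hs1 : s ≤ 1)
    (hS0 : 0 ≤ S') (hS1 : S' ≤ 1) (hu : S' * (1 - A') ≤ u') :
    s * S' * (1 - A * A') ≤ (1 - A) + A * s * u' := by
  have h1 : A * s * (S' * (1 - A')) ≤ A * s * u' := mul_le_mul_of_nonneg_left hu (mul_nonneg hA0 hs0)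
  have h2 : s * S' ≤ 1 := by nlinarith [mul_le_mul hs1 hS1 hS0 (by norm_num : (0:ℝ) ≤ 1)]
  have h3 : 0 ≤ s * S' := mul_nonneg hs0 hS0
  nlinarith [mul_nonneg (sub_nonneg.mpr hA1) (sub_nonneg.mpr h2), h3]

end PocketCert

end Summit.CriticalPhenomena.PercolationContinuityZ3.Theorems
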